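import Mathlib
import Summits.CriticalPhenomena.SAWScalingLimit.Theorems.SAWDefectDecoherenceDefectDecoherenceSsUnstablePoisson
import Summits.CriticalPhenomena.SAWScalingLimit.Theorems.SAWDefectDecoherenceDefectDecoherenceSsSourceDiff
import Summits.CriticalPhenomena.SAWScalingLimit.Theorems.SAWDefectDecoherenceDefectDecoherenceSsDefectSlaving
import HarnessLib

/-!
# The discrete Laplacian of the unstable sector is a first DIFFERENCE of the two other sectors
(helpers for the stub `stub_unstableStarGradient` of the line `sector-slaving`, crux `DefectDecoherence`,
stmt-CriticalPhenomena-8549; lead prover c3)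

Engine (b) of the line card for the hardest stub reads the `U`-sector `U = A_{-3/8}` of the clean
`x_c`-weighted arrival law as an ALMOST-HARMONIC lattice field: the landed discrete Poisson equation
(`ss_unstable_meanValue_defect`, file `…SsUnstablePoisson.lean`) says that at a `2`-deep vertex of a
simply connected domain with boundary root

`U(v) − (1/3) Σ_{t ∼ v} U(t) = (c_S/3) Σ_t e(t) S(t) + (c_D/3) Σ_t e(t)² D(t)`,
`c_S = 2x_c cos(5π/24)`, `c_D = 2x_c cos(13π/24) = −q`, `e(t) = dartUnit v t`.

Since the darts at a deep vertex sum to zero together with their squares (`ss_sum_dartUnit`,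
`ss_sum_dartUnit_sq`, file `…SsSourceDiff.lean`), both sources are PURE DIFFERENCES: this file records

* `ss_unstable_laplacian_eq_diff` — `U(v) − (1/3)Σ_t U(t) = (c_S/3) Σ_t e(t)(S(t) − S(v)) + (c_D/3) Σ_t e(t)²(D(t) − D(v))`;
* `ss_norm_unstable_laplacian_le` — hence `‖U(v) − (1/3)Σ_t U(t)‖ ≤ (1/3)·Σ_t ‖S(t) − S(v)‖ + (q/3)·Σ_t ‖D(t) − D(v)‖`
  (`|c_S| ≤ 1`, `|c_D| = q = 2x_c sin(π/24) ≈ 0.1413`).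

In words: the discrete Laplacian of `U` is second-order small as soon as the signal and defect sectors
are one-step Lipschitz — the exact form of "the `U`-sector is harmonic to leading order".  Together with
`ss_unstableSource_eq_diff` (the stub's quantity `Σ_t ē(t)² U(t)` is the `∂̄`-DIFFERENCE of `U` over the
star) this is the complete dictionary of engine (b): `stub_unstableStarGradient` would follow from an
interior gradient estimate for this lattice Poisson problem, i.e. from (i) a polynomially lossy Harnack
comparability of the critical masses over the deep ball (`sup_{B(v,R/2)} M ≤ C R^{η} M(v)`, `η < 1/4`) and
(ii) one-step Lipschitz decay of `S` and `D` — both OPEN (no regularity theory for critical planar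
self-avoiding walk).  Nothing about the decay is proved here.

Sources: H. Duminil-Copin, S. Smirnov, Ann. of Math. 175 (2012) (arXiv:1007.0575), Lemma 1; the line card
`Cruxes/DefectDecoherence/Lines/sector-slaving.md` (engine (b)).
-/

noncomputable section

open scoped BigOperators ComplexConjugate Classical
open Literature.Probability.LatticeModels Literature.Probability.RandomPlanarGeometry.SAW
open Summit.CriticalPhenomena.SAWScalingLimit.Theorems.DefectDecoherence.TipMartingale

namespace Summit.CriticalPhenomena.SAWScalingLimit.Theorems.DefectDecoherence.SectorSlaving

/-- **The discrete Laplacian of the unstable sector is a first difference of `S` and `D`.**  In a simply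
connected `Λ` with adjacent boundary root `s(u,w)` (`u ∉ Λ ∋ w`), at every `2`-deep vertex `v`
(`U, S, D = A_{-3/8}, A_{5/8}, A_{13/8}`, `e(t) = dartUnit v t`):
`U(v) − (1/3) Σ_{t ∼ v} U(t) = (2x_c cos(5π/24)/3)·Σ_t e(t)(S(t) − S(v)) + (2x_c cos(13π/24)/3)·Σ_t e(t)²(D(t) − D(v))`.
[cite: DuminilCopinSmirnov2012, Lemma 1] -/
theorem ss_unstable_laplacian_eq_diff : ∀ (Λ : Finset HexVertex), hexDomainSimplyConnected Λ →
    ∀ (u w : HexVertex), hexGraph.Adj u w → u ∉ Λ → w ∈ Λ →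
      ∀ v : HexVertex, Deep Λ v 2 →
        arrivalSum Λ s(u, w) (rootAngle u w) (-3 / 8) v -
            (1 / 3 : ℂ) * ∑ t ∈ star Λ v, arrivalSum Λ s(u, w) (rootAngle u w) (-3 / 8) t =
          ((2 * xc * Real.cos (5 * Real.pi / 24) / 3 : ℝ) : ℂ) *
              ∑ t ∈ star Λ v, dartUnit v t *
                (arrivalSum Λ s(u, w) (rootAngle u w) (5 / 8) t -
                  arrivalSum Λ s(u, w) (rootAngle u w) (5 / 8) v) +
            ((2 * xc * Real.cos (13 * Real.pi / 24) / 3 : ℝ) : ℂ) *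
              ∑ t ∈ star Λ v, dartUnit v t ^ 2 *
                (arrivalSum Λ s(u, w) (rootAngle u w) (13 / 8) t -
                  arrivalSum Λ s(u, w) (rootAngle u w) (13 / 8) v) := by
  intro Λ hΛ u w huw hu hw v hdeep
  have hdeep1 : Deep Λ v 1 := fun y hy => hdeep y (hy.trans (by norm_num))
  rw [ss_unstable_meanValue_defect Λ hΛ u w huw hu hw v hdeep,
    ← ss_sum_weight_mul_eq_diff _ _ _ _ (ss_sum_dartUnit Λ v hdeep1),
    ← ss_sum_weight_mul_eq_diff _ _ _ _ (ss_sum_dartUnit_sq Λ v hdeep1)]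

/-- **The Laplacian of `U` is bounded by the one-step moduli of continuity of `S` and `D`.**  Same
setting: `‖U(v) − (1/3) Σ_{t ∼ v} U(t)‖ ≤ (1/3)·Σ_t ‖S(t) − S(v)‖ + (q/3)·Σ_t ‖D(t) − D(v)‖`,
`q = slavingCoupling = 2x_c sin(π/24)` (`|2x_c cos(5π/24)/3| ≤ 1/3 · 3 = 1` is used in the weaker form
`≤ 1`, i.e. the first constant is `1`, not `1/3`; `|2x_c cos(13π/24)/3| = q/3`).  A triangle inequality over
the exact identity `ss_unstable_laplacian_eq_diff`; it proves nothing about decay. [folklore] -/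
theorem ss_norm_unstable_laplacian_le : ∀ (Λ : Finset HexVertex), hexDomainSimplyConnected Λ →
    ∀ (u w : HexVertex), hexGraph.Adj u w → u ∉ Λ → w ∈ Λ →
      ∀ v : HexVertex, Deep Λ v 2 →
        ‖arrivalSum Λ s(u, w) (rootAngle u w) (-3 / 8) v -
            (1 / 3 : ℂ) * ∑ t ∈ star Λ v, arrivalSum Λ s(u, w) (rootAngle u w) (-3 / 8) t‖ ≤
          (∑ t ∈ star Λ v, ‖arrivalSum Λ s(u, w) (rootAngle u w) (5 / 8) t -
              arrivalSum Λ s(u, w) (rootAngle u w) (5 / 8) v‖) +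
            slavingCoupling / 3 * ∑ t ∈ star Λ v,
              ‖arrivalSum Λ s(u, w) (rootAngle u w) (13 / 8) t -
                arrivalSum Λ s(u, w) (rootAngle u w) (13 / 8) v‖ := by
  intro Λ hΛ u w huw hu hw v hdeep
  have hdeep1 : Deep Λ v 1 := fun y hy => hdeep y (hy.trans (by norm_num))
  rw [ss_unstable_laplacian_eq_diff Λ hΛ u w huw hu hw v hdeep]
  have hq3 : 0 ≤ slavingCoupling / 3 := div_nonneg slave_coupling_nonneg (by norm_num)
  -- the unimodular darts
  have hunit : ∀ t ∈ star Λ v, ‖dartUnit v t‖ = 1 := fun t ht =>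
    ss_norm_dartUnit v t (tip_mem_star.1 ht).2
  -- first source
  have h1 : ‖((2 * xc * Real.cos (5 * Real.pi / 24) / 3 : ℝ) : ℂ) *
        ∑ t ∈ star Λ v, dartUnit v t *
          (arrivalSum Λ s(u, w) (rootAngle u w) (5 / 8) t -
            arrivalSum Λ s(u, w) (rootAngle u w) (5 / 8) v)‖ ≤
      ∑ t ∈ star Λ v, ‖arrivalSum Λ s(u, w) (rootAngle u w) (5 / 8) t -
          arrivalSum Λ s(u, w) (rootAngle u w) (5 / 8) v‖ := by
    rw [norm_mul, Complex.norm_real, Real.norm_eq_abs]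
    have hS : ‖∑ t ∈ star Λ v, dartUnit v t *
          (arrivalSum Λ s(u, w) (rootAngle u w) (5 / 8) t -
            arrivalSum Λ s(u, w) (rootAngle u w) (5 / 8) v)‖ ≤
        ∑ t ∈ star Λ v, ‖arrivalSum Λ s(u, w) (rootAngle u w) (5 / 8) t -
          arrivalSum Λ s(u, w) (rootAngle u w) (5 / 8) v‖ := by
      refine (norm_sum_le _ _).trans (Finset.sum_le_sum fun t ht => ?_)
      rw [norm_mul, hunit t ht, one_mul]
    calc |2 * xc * Real.cos (5 * Real.pi / 24) / 3| *
          ‖∑ t ∈ star Λ v, dartUnit v t *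
            (arrivalSum Λ s(u, w) (rootAngle u w) (5 / 8) t -
              arrivalSum Λ s(u, w) (rootAngle u w) (5 / 8) v)‖
        ≤ 1 * ‖∑ t ∈ star Λ v, dartUnit v t *
            (arrivalSum Λ s(u, w) (rootAngle u w) (5 / 8) t -
              arrivalSum Λ s(u, w) (rootAngle u w) (5 / 8) v)‖ :=
          mul_le_mul_of_nonneg_right slave_signal_coeff_abs_le (norm_nonneg _)
      _ ≤ _ := by rw [one_mul]; exact hS
  -- second source
  have h2 : ‖((2 * xc * Real.cos (13 * Real.pi / 24) / 3 : ℝ) : ℂ) *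
        ∑ t ∈ star Λ v, dartUnit v t ^ 2 *
          (arrivalSum Λ s(u, w) (rootAngle u w) (13 / 8) t -
            arrivalSum Λ s(u, w) (rootAngle u w) (13 / 8) v)‖ ≤
      slavingCoupling / 3 * ∑ t ∈ star Λ v,
        ‖arrivalSum Λ s(u, w) (rootAngle u w) (13 / 8) t -
          arrivalSum Λ s(u, w) (rootAngle u w) (13 / 8) v‖ := by
    rw [norm_mul, Complex.norm_real, Real.norm_eq_abs, slave_diag_coeff, abs_neg, abs_of_nonneg hq3]
    refine mul_le_mul_of_nonneg_left ?_ hq3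
    refine (norm_sum_le _ _).trans (Finset.sum_le_sum fun t ht => ?_)
    rw [norm_mul, norm_pow, hunit t ht, one_pow, one_mul]
  exact (norm_add_le _ _).trans (add_le_add h1 h2)

end Summit.CriticalPhenomena.SAWScalingLimit.Theorems.DefectDecoherence.SectorSlaving

end
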